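import Mathlib
import HarnessLib
import Summits.ValiantsHypothesis.ValiantsHypothesis.Theorems.LacunarySymmetroidMatrixDescartesOsculationLawRankTwoColumnDet

/-!
# ValiantsHypothesis / LacunarySymmetroid — crux `MatrixDescartes` (stmt-ValiantsHypothesis-18050, V1),
# line «osculation-law»: a RANK-`r` LETTER is a degree-`r` polynomial in `b` (all block splittings at once)

Determinant bookkeeping for every splitting `(r, s)` of the osculation law.  For a square matrix `G` over a
commutative ring, a finite set `T` of row indices and a scalar `b`,

  `det(G + b·1_T) = Σ_{U ⊆ T} b^|U| · det G[U := unit rows]`          (`det_add_smul_indicator`)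

where `1_T` is the diagonal indicator of `T` and `G[U := unit rows]` is `G` with every row `i ∈ U` replaced by the
unit vector `e_i` (so `det G[U := …]` is the principal cofactor complementary to `U`).  On `Fin r ⊕ Fin s` with
`T = inl(Fin r)` the indicator is the block projector `I_r ⊕ 0` and `G[T := unit rows] = [[I_r, 0], [G₂₁, G₂₂]]` has
determinant `det G₂₂` (`indicator_inl_eq_blockProj`, `det_unitRows_inl`).  For a `K`-nomial pencil with exponent
set `E`, Leibniz with `|U|` constant rows gives `supp det G[U := unit rows] ⊆ (n − |U|) • E` (`supp_det_unitRows`).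
Honest framing: bookkeeping only (it generalises `OsculationRankTwo.det_add_smul_blockProj_two` from `r = 2` to all
`r`); nothing here bears on `OsculationLaw`, `MatrixDescartes`, Conjecture B or `VP ≠ VNP`.  No definitions (the two
matrix shapes are written inline with `Matrix.of`), no named facts; Mathlib + tree osculation files only.
-/

-- `Summit.ValiantsHypothesis.ValiantsHypothesis.…` is the tree's mandated single-conjunct layout (Sub = Summit).
set_option linter.dupNamespace false

namespace Summit.ValiantsHypothesis.ValiantsHypothesis.Theorems.LacunarySymmetroidMatrixDescartes

namespace OsculationLetter

open scoped BigOperators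

variable {ι R : Type*} [DecidableEq ι] [CommRing R]

/-- Inserting one more index into the indicator is one more row update. [folklore] -/
theorem add_smul_indicator_insert (G : Matrix ι ι R) (T : Finset ι) (a : ι) (haT : a ∉ T) (b : R) :
    G + b • Matrix.of (fun i j : ι => if i = j ∧ i ∈ insert a T then (1 : R) else 0) =
      G.updateRow a (G a + b • (Pi.single a 1 : ι → R))
        + b • Matrix.of (fun i j : ι => if i = j ∧ i ∈ T then (1 : R) else 0) := by
  ext i j
  simp only [Matrix.add_apply, Matrix.smul_apply, Matrix.of_apply, Matrix.updateRow_apply, smul_eq_mul,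
    Pi.add_apply, Pi.smul_apply, Finset.mem_insert]
  by_cases hi : i = a
  · subst hi
    by_cases hj : i = j
    · subst hj; simp [haT]
    · simp [hj, Ne.symm hj]
  · simp [hi]

/-- Row `a ∉ U` of `G[U := unit rows]` updated to `e_a` is `G[insert a U := unit rows]`. [folklore] -/
theorem unitRows_updateRow (G : Matrix ι ι R) (U : Finset ι) (a : ι) :
    (Matrix.of fun i j : ι => if i ∈ U then (Pi.single i (1 : R) : ι → R) j else G i j).updateRow a
        (Pi.single a 1 : ι → R) =
      Matrix.of fun i j : ι => if i ∈ insert a U then (Pi.single i (1 : R) : ι → R) j else G i j := by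
  ext i j
  simp only [Matrix.updateRow_apply, Matrix.of_apply, Finset.mem_insert]
  by_cases hi : i = a
  · subst hi; simp
  · simp [hi]

/-- `G[U := unit rows]` for the updated `G` (`a ∉ U`): the update passes to row `a`. [folklore] -/
theorem unitRows_of_updateRow (G : Matrix ι ι R) (U : Finset ι) (a : ι) (haU : a ∉ U) (v : ι → R) :
    (Matrix.of fun i j : ι => if i ∈ U then (Pi.single i (1 : R) : ι → R) j else (G.updateRow a v) i j) =
      (Matrix.of fun i j : ι => if i ∈ U then (Pi.single i (1 : R) : ι → R) j else G i j).updateRow a v := by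
  ext i j
  simp only [Matrix.updateRow_apply, Matrix.of_apply]
  by_cases hi : i = a
  · subst hi; simp [haU]
  · simp [hi]

/-- Row `a ∉ U` of `G[U := unit rows]` is row `a` of `G`. [folklore] -/
theorem unitRows_row (G : Matrix ι ι R) (U : Finset ι) (a : ι) (haU : a ∉ U) :
    (Matrix.of fun i j : ι => if i ∈ U then (Pi.single i (1 : R) : ι → R) j else G i j) a = G a := by
  funext j
  simp [Matrix.of_apply, haU]

/-- **A rank-`|T|` diagonal letter is a polynomial in `b`**: `det(G + b·1_T) = Σ_{U ⊆ T} b^|U| det G[U := unit rows]`.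
[folklore] -/
theorem det_add_smul_indicator [Fintype ι] (G : Matrix ι ι R) (T : Finset ι) (b : R) :
    (G + b • Matrix.of (fun i j : ι => if i = j ∧ i ∈ T then (1 : R) else 0)).det =
      ∑ U ∈ T.powerset, b ^ U.card *
        (Matrix.of fun i j : ι => if i ∈ U then (Pi.single i (1 : R) : ι → R) j else G i j).det := by
  induction T using Finset.induction_on generalizing G with
  | empty =>
    have h0 : Matrix.of (fun i j : ι => if i = j ∧ i ∈ (∅ : Finset ι) then (1 : R) else 0) = 0 := by
      ext i j; simp
    have h1 : (Matrix.of fun i j : ι => if i ∈ (∅ : Finset ι) then (Pi.single i (1 : R) : ι → R) j else G i j) = G := by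
      ext i j; simp
    rw [h0, smul_zero, add_zero, Finset.powerset_empty, Finset.sum_singleton, Finset.card_empty, pow_zero, one_mul,
      h1]
  | @insert a T haT ih =>
    rw [add_smul_indicator_insert G T a haT b, ih, Finset.powerset_insert, Finset.sum_union, Finset.sum_image]
    · -- the two halves
      have hsplit : ∀ U ∈ T.powerset,
          (Matrix.of fun i j : ι => if i ∈ U then (Pi.single i (1 : R) : ι → R) j
            else (G.updateRow a (G a + b • (Pi.single a 1 : ι → R))) i j).det =
          (Matrix.of fun i j : ι => if i ∈ U then (Pi.single i (1 : R) : ι → R) j else G i j).det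
            + b * (Matrix.of fun i j : ι => if i ∈ insert a U then (Pi.single i (1 : R) : ι → R) j else G i j).det := by
        intro U hU
        have haU : a ∉ U := fun h => haT (Finset.mem_powerset.1 hU h)
        have e1 : (Matrix.of fun i j : ι => if i ∈ U then (Pi.single i (1 : R) : ι → R) j else G i j).updateRow a
            (G a) = (Matrix.of fun i j : ι => if i ∈ U then (Pi.single i (1 : R) : ι → R) j else G i j) := by
          ext i j
          by_cases hi : i = a
          · subst hi; simp [Matrix.updateRow_apply, haU]
          · simp [Matrix.updateRow_apply, hi]
        rw [unitRows_of_updateRow G U a haU, Matrix.det_updateRow_add, e1, Matrix.det_updateRow_smul,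
          unitRows_updateRow]
      rw [Finset.sum_congr rfl fun U hU => by rw [hsplit U hU], Finset.sum_congr rfl fun U hU => by rw [mul_add]]
      rw [Finset.sum_add_distrib]
      congr 1
      refine Finset.sum_congr rfl fun U hU => ?_
      have haU : a ∉ U := fun h => haT (Finset.mem_powerset.1 hU h)
      rw [Finset.card_insert_of_notMem haU, pow_succ]
      ring
    · -- `insert a` is injective on `T.powerset`
      intro U hU V hV hUV
      have haU : a ∉ U := fun h => haT (Finset.mem_powerset.1 (Finset.mem_coe.1 hU) h)
      have haV : a ∉ V := fun h => haT (Finset.mem_powerset.1 (Finset.mem_coe.1 hV) h)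
      rw [← Finset.erase_insert haU, hUV, Finset.erase_insert haV]
    · -- the two halves are disjoint (`a ∉ U` versus `a ∈ insert a V`)
      rw [Finset.disjoint_left]
      intro U hU hU'
      obtain ⟨V, -, hVU⟩ := Finset.mem_image.1 hU'
      have haU : a ∉ U := fun h => haT (Finset.mem_powerset.1 hU h)
      exact haU (hVU ▸ Finset.mem_insert_self a V)

/-! ### The block splitting `Fin r ⊕ Fin s` -/

/-- The indicator of `inl(Fin r)` is the block projector `I_r ⊕ 0`. [folklore] -/
theorem indicator_inl_eq_blockProj (r s : ℕ) :
    Matrix.of (fun i j : Fin r ⊕ Fin s => if i = j ∧ i ∈ (Finset.univ.map Function.Embedding.inl) then (1 : R) else 0) =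
      (Matrix.fromBlocks 1 0 0 0 : Matrix (Fin r ⊕ Fin s) (Fin r ⊕ Fin s) R) := by
  ext i j
  rcases i with i | i <;> rcases j with j | j <;> simp [Matrix.one_apply]

/-- All `inl` rows replaced by unit rows: `[[I_r, 0], [G₂₁, G₂₂]]`, of determinant `det G₂₂`. [folklore] -/
theorem det_unitRows_inl (r s : ℕ) (G : Matrix (Fin r ⊕ Fin s) (Fin r ⊕ Fin s) R) :
    (Matrix.of fun i j : Fin r ⊕ Fin s => if i ∈ (Finset.univ.map Function.Embedding.inl : Finset (Fin r ⊕ Fin s))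
        then (Pi.single i (1 : R) : Fin r ⊕ Fin s → R) j else G i j).det = G.toBlocks₂₂.det := by
  have h : (Matrix.of fun i j : Fin r ⊕ Fin s => if i ∈ (Finset.univ.map Function.Embedding.inl : Finset (Fin r ⊕ Fin s))
        then (Pi.single i (1 : R) : Fin r ⊕ Fin s → R) j else G i j) = Matrix.fromBlocks 1 0 G.toBlocks₂₁ G.toBlocks₂₂ := by
    ext i j
    rcases i with i | i <;> rcases j with j | j <;>
      simp [Matrix.one_apply, Pi.single_apply, Matrix.toBlocks₂₁, Matrix.toBlocks₂₂, eq_comm]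
  rw [h, Matrix.det_fromBlocks_zero₁₂, Matrix.det_one, one_mul]

/-! ### Monomial bookkeeping: principal cofactors of a pencil -/

section support

open Polynomial
open scoped Pointwise

/-- Leibniz with `|U|` constant rows: the exponents of `det` of a `K`-nomial `n × n` pencil with the rows in `U`
replaced by unit rows (the principal cofactor complementary to `U`) lie in `(n − |U|) • E`. [folklore] -/
theorem supp_det_unitRows {ι : Type*} [Fintype ι] [DecidableEq ι] {K : ℕ} (d : Fin K → ℕ)
    (T : Fin K → Matrix ι ι ℝ) (U : Finset ι) :
    ((Matrix.of fun i j : ι => if i ∈ U then (Pi.single i (1 : ℝ[X]) : ι → ℝ[X]) j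
        else (∑ l, (X : ℝ[X]) ^ d l • (T l).map Polynomial.C) i j).det).support ⊆
      (Fintype.card ι - U.card) • Finset.univ.image d := by
  classical
  rw [Matrix.det_apply']
  refine OsculationTwoK.supp_sum _ _ fun σ _ => OsculationTwoK.supp_intCast_mul _ ?_
  rw [← Finset.prod_filter_mul_prod_filter_not Finset.univ (fun i => σ i ∈ U)]
  have hA : (∏ x ∈ Finset.univ.filter (fun i => σ i ∈ U),
      (Matrix.of fun i j : ι => if i ∈ U then (Pi.single i (1 : ℝ[X]) : ι → ℝ[X]) j
        else (∑ l, (X : ℝ[X]) ^ d l • (T l).map Polynomial.C) i j) (σ x) x).support ⊆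
      ((Finset.univ.filter (fun i => σ i ∈ U)).card * 0) • Finset.univ.image d := by
    refine OsculationTwoK.supp_prod _ _ fun x hx => ?_
    rw [Finset.mem_filter] at hx
    simp only [Matrix.of_apply, if_pos hx.2]
    exact OsculationRankTwo.supp_single_apply _ _ _
  have hB : (∏ x ∈ Finset.univ.filter (fun i => ¬ σ i ∈ U),
      (Matrix.of fun i j : ι => if i ∈ U then (Pi.single i (1 : ℝ[X]) : ι → ℝ[X]) j
        else (∑ l, (X : ℝ[X]) ^ d l • (T l).map Polynomial.C) i j) (σ x) x).support ⊆
      ((Finset.univ.filter (fun i => ¬ σ i ∈ U)).card * 1) • Finset.univ.image d := by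
    refine OsculationTwoK.supp_prod _ _ fun x hx => ?_
    rw [Finset.mem_filter] at hx
    simp only [Matrix.of_apply, if_neg hx.2]
    exact OsculationTwoK.support_pencil_apply d T (σ x) x
  refine OsculationCusp.supp_cast (OsculationCusp.supp_mul hA hB) ?_
  have hcardA : (Finset.univ.filter (fun i => σ i ∈ U)).card = U.card := by
    have : Finset.univ.filter (fun i => σ i ∈ U) = U.map σ.symm.toEmbedding := by
      ext i
      simp [Finset.mem_map_equiv]
    rw [this, Finset.card_map]
  have hsum := Finset.card_filter_add_card_filter_not (s := (Finset.univ : Finset ι)) (fun i => σ i ∈ U)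
  rw [Finset.card_univ] at hsum
  omega

end support

/-! ### The insertion polynomial of a rank-`r` letter, all splittings `(r, s)` at once -/

section pencil

open Polynomial
open scoped Pointwise

/-- The coefficient embedding commutes with «replace the rows in `U` by unit rows». [folklore] -/
theorem unitRows_map {ι A B : Type*} [DecidableEq ι] [Zero A] [One A] [Zero B] [One B] (G : Matrix ι ι A)
    (U : Finset ι) {f : A → B} (h0 : f 0 = 0) (h1 : f 1 = 1) :
    (Matrix.of fun i j : ι => if i ∈ U then (Pi.single i (1 : A) : ι → A) j else G i j).map f =
      Matrix.of fun i j : ι => if i ∈ U then (Pi.single i (1 : B) : ι → B) j else (G.map f) i j := by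
  ext i j
  simp only [Matrix.map_apply, Matrix.of_apply]
  split_ifs with h
  · rcases eq_or_ne j i with rfl | hji
    · simp [h1]
    · simp [hji, h0]
  · rfl

/-- The block projector survives the coefficient embedding (any `r`, `s`). [folklore] -/
theorem blockProj_map_gen {A B : Type*} [Zero A] [One A] [Zero B] [One B] (r s : ℕ) {f : A → B} (h0 : f 0 = 0)
    (h1 : f 1 = 1) :
    (Matrix.fromBlocks 1 0 0 0 : Matrix (Fin r ⊕ Fin s) (Fin r ⊕ Fin s) A).map f =
      (Matrix.fromBlocks 1 0 0 0 : Matrix (Fin r ⊕ Fin s) (Fin r ⊕ Fin s) B) := by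
  rw [Matrix.fromBlocks_map, Matrix.map_one f h0 h1, Matrix.map_zero f h0, Matrix.map_zero f h0,
    Matrix.map_zero f h0]

/-- **The insertion polynomial of a rank-`r` letter** (`ι : X ↦ X₀`):
`det(Σ_l X₀^(d l) S_l + X₁·(I_r ⊕ 0)) = Σ_{U ⊆ inl(Fin r)} X₁^|U| · ι(det G[U := unit rows])`. [folklore] -/
theorem insertionPoly_rank (r s : ℕ) {K : ℕ} (d : Fin K → ℕ) (S : Fin K → Matrix (Fin r ⊕ Fin s) (Fin r ⊕ Fin s) ℝ) :
    (∑ l, (MvPolynomial.X (0 : Fin 2) : MvPolynomial (Fin 2) ℝ) ^ d l •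
              (S l).map (MvPolynomial.C : ℝ →+* MvPolynomial (Fin 2) ℝ)
            + (MvPolynomial.X (1 : Fin 2) : MvPolynomial (Fin 2) ℝ) •
              (Matrix.fromBlocks 1 0 0 0 : Matrix (Fin r ⊕ Fin s) (Fin r ⊕ Fin s) ℝ).map
                (MvPolynomial.C : ℝ →+* MvPolynomial (Fin 2) ℝ)).det =
      ∑ U ∈ (Finset.univ.map Function.Embedding.inl : Finset (Fin r ⊕ Fin s)).powerset,
        (MvPolynomial.X 1 : MvPolynomial (Fin 2) ℝ) ^ U.card *
          Polynomial.aeval (MvPolynomial.X 0 : MvPolynomial (Fin 2) ℝ)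
            (Matrix.of fun i j : Fin r ⊕ Fin s => if i ∈ U then (Pi.single i (1 : ℝ[X]) : Fin r ⊕ Fin s → ℝ[X]) j
              else (∑ l, (X : ℝ[X]) ^ d l • (S l).map Polynomial.C) i j).det := by
  rw [← OsculationTwoK.map_aevalX0_pencil_gen d S, blockProj_map_gen r s (map_zero _) (map_one _),
    ← indicator_inl_eq_blockProj r s, det_add_smul_indicator]
  refine Finset.sum_congr rfl fun U _ => ?_
  rw [AlgHom.map_det, AlgHom.mapMatrix_apply, unitRows_map _ _ (map_zero _) (map_one _)]

/-- Supports of the coefficients: `supp det G[U := unit rows] ⊆ (r + s − |U|) • E`. [folklore] -/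
theorem supp_coeff_rank (r s : ℕ) {K : ℕ} (d : Fin K → ℕ) (S : Fin K → Matrix (Fin r ⊕ Fin s) (Fin r ⊕ Fin s) ℝ)
    (U : Finset (Fin r ⊕ Fin s)) :
    ((Matrix.of fun i j : Fin r ⊕ Fin s => if i ∈ U then (Pi.single i (1 : ℝ[X]) : Fin r ⊕ Fin s → ℝ[X]) j
        else (∑ l, (X : ℝ[X]) ^ d l • (S l).map Polynomial.C) i j).det).support ⊆ (r + s - U.card) • Finset.univ.image d :=
  OsculationCusp.supp_cast (supp_det_unitRows d S U) (by simp [Fintype.card_sum, Fintype.card_fin])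

end pencil

/-! ### Real-rootedness of a rank-`r` letter for symmetric matrices (Schur complement + spectral theorem) -/

section realRoots

open Polynomial

/-- **Symmetric rank-`r` letters are real-rooted.**  For a real symmetric `G` on `Fin r ⊕ Fin s` with `det G₂₂ ≠ 0`,
`det(G + b·(I_r ⊕ 0)) = det G₂₂ · ∏ᵢ (b − μᵢ)` for the `r` real numbers `μᵢ = −λᵢ(Σ)`, `Σ = G₁₁ − G₁₂ G₂₂⁻¹ G₂₁` the
(symmetric) Schur complement (`Matrix.det_fromBlocks₂₂`, `Matrix.IsHermitian.charpoly_eq`). [folklore] -/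
theorem prod_roots_add_smul_blockProj (r s : ℕ) (G : Matrix (Fin r ⊕ Fin s) (Fin r ⊕ Fin s) ℝ) (hG : G.IsSymm)
    (hD : G.toBlocks₂₂.det ≠ 0) :
    ∃ μ : Fin r → ℝ, ∀ b : ℝ,
      (G + b • (Matrix.fromBlocks 1 0 0 0 : Matrix (Fin r ⊕ Fin s) (Fin r ⊕ Fin s) ℝ)).det =
        G.toBlocks₂₂.det * ∏ i, (b - μ i) := by
  haveI : Invertible G.toBlocks₂₂ := Matrix.invertibleOfIsUnitDet _ (Ne.isUnit hD)
  set Sc : Matrix (Fin r) (Fin r) ℝ := G.toBlocks₁₁ - G.toBlocks₁₂ * ⅟G.toBlocks₂₂ * G.toBlocks₂₁ with hSc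
  have h11 : G.toBlocks₁₁.transpose = G.toBlocks₁₁ := by ext i j; exact hG.apply (Sum.inl i) (Sum.inl j)
  have h12 : G.toBlocks₁₂.transpose = G.toBlocks₂₁ := by ext i j; exact hG.apply (Sum.inr i) (Sum.inl j)
  have h21 : G.toBlocks₂₁.transpose = G.toBlocks₁₂ := by ext i j; exact hG.apply (Sum.inl i) (Sum.inr j)
  have h22 : G.toBlocks₂₂.transpose = G.toBlocks₂₂ := by ext i j; exact hG.apply (Sum.inr i) (Sum.inr j)
  have hinv : (⅟G.toBlocks₂₂).transpose = ⅟G.toBlocks₂₂ := by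
    rw [Matrix.invOf_eq_nonsing_inv, Matrix.transpose_nonsing_inv, h22]
  have hSct : Sc.transpose = Sc := by
    rw [hSc, Matrix.transpose_sub, Matrix.transpose_mul, Matrix.transpose_mul, h11, h12, h21, hinv, Matrix.mul_assoc]
  have hH : (-Sc).IsHermitian := by
    rw [Matrix.isHermitian_iff_isSymm]
    exact Matrix.IsSymm.neg hSct
  refine ⟨fun i => hH.eigenvalues i, fun b => ?_⟩
  have hGb : G + b • (Matrix.fromBlocks 1 0 0 0 : Matrix (Fin r ⊕ Fin s) (Fin r ⊕ Fin s) ℝ) =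
      Matrix.fromBlocks (G.toBlocks₁₁ + b • 1) G.toBlocks₁₂ G.toBlocks₂₁ G.toBlocks₂₂ := by
    conv_lhs => rw [← Matrix.fromBlocks_toBlocks G]
    rw [Matrix.fromBlocks_smul, Matrix.fromBlocks_add, smul_zero, smul_zero, smul_zero, add_zero, add_zero, add_zero]
  have hS : G.toBlocks₁₁ + b • (1 : Matrix (Fin r) (Fin r) ℝ) - G.toBlocks₁₂ * ⅟G.toBlocks₂₂ * G.toBlocks₂₁ =
      Matrix.scalar (Fin r) b - (-Sc) := by
    rw [Matrix.scalar_apply, ← Matrix.smul_one_eq_diagonal, hSc, sub_neg_eq_add]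
    abel
  rw [hGb, Matrix.det_fromBlocks₂₂, hS, ← Matrix.eval_charpoly, hH.charpoly_eq, Polynomial.eval_prod]
  simp only [Polynomial.eval_sub, Polynomial.eval_X, Polynomial.eval_C, RCLike.ofReal_real_eq_id, id_eq]

/-- The same for a symmetric block pencil at every abscissa `t` with `det G₂₂(t) ≠ 0`, in terms of the evaluated
principal cofactors `(det G[U := unit rows])(t)` of `insertionPoly_rank`. [folklore] -/
theorem prod_roots_pencil_rank (r s : ℕ) {K : ℕ} (d : Fin K → ℕ) (S : Fin K → Matrix (Fin r ⊕ Fin s) (Fin r ⊕ Fin s) ℝ)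
    (hS : ∀ l, (S l).IsSymm) (t : ℝ) (hD : ((∑ l, (X : ℝ[X]) ^ d l • ((S l).toBlocks₂₂).map Polynomial.C).det).eval t ≠ 0) :
    ∃ μ : Fin r → ℝ, ∀ b : ℝ,
      ∑ U ∈ (Finset.univ.map Function.Embedding.inl : Finset (Fin r ⊕ Fin s)).powerset, b ^ U.card *
        ((Matrix.of fun i j : Fin r ⊕ Fin s => if i ∈ U then (Pi.single i (1 : ℝ[X]) : Fin r ⊕ Fin s → ℝ[X]) j
          else (∑ l, (X : ℝ[X]) ^ d l • (S l).map Polynomial.C) i j).det).eval t =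
      ((∑ l, (X : ℝ[X]) ^ d l • ((S l).toBlocks₂₂).map Polynomial.C).det).eval t * ∏ i, (b - μ i) := by
  have hGt : ((∑ l, (X : ℝ[X]) ^ d l • (S l).map Polynomial.C).map (Polynomial.evalRingHom t)).IsSymm := (OsculationRankTwo.pencil_isSymm d S hS).map _
  have h22 : ∀ {K' : ℕ} (d' : Fin K' → ℕ) (S' : Fin K' → Matrix (Fin r ⊕ Fin s) (Fin r ⊕ Fin s) ℝ),
      (∑ l, (X : ℝ[X]) ^ d' l • (S' l).map Polynomial.C).toBlocks₂₂ =
        (∑ l, (X : ℝ[X]) ^ d' l • ((S' l).toBlocks₂₂).map Polynomial.C) := by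
    intro K' d' S'
    ext i j
    simp only [Matrix.toBlocks₂₂, Matrix.of_apply, Matrix.sum_apply, Matrix.smul_apply, Matrix.map_apply]
  have e22 : ((∑ l, (X : ℝ[X]) ^ d l • ((S l).toBlocks₂₂).map Polynomial.C).det).eval t = (((∑ l, (X : ℝ[X]) ^ d l • (S l).map Polynomial.C).map (Polynomial.evalRingHom t)).toBlocks₂₂).det := by
    rw [← h22, ← Polynomial.coe_evalRingHom, RingHom.map_det, RingHom.mapMatrix_apply]; rfl
  rw [e22] at hD ⊢
  obtain ⟨μ, hμ⟩ := prod_roots_add_smul_blockProj r s _ hGt hD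
  refine ⟨μ, fun b => ?_⟩
  rw [← hμ b, ← indicator_inl_eq_blockProj r s, det_add_smul_indicator]
  refine Finset.sum_congr rfl fun U _ => ?_
  rw [← Polynomial.coe_evalRingHom, RingHom.map_det, RingHom.mapMatrix_apply,
    unitRows_map _ _ (map_zero _) (map_one _)]

end realRoots

end OsculationLetter

end Summit.ValiantsHypothesis.ValiantsHypothesis.Theorems.LacunarySymmetroidMatrixDescartes
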